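import Summits.FinalStateConjecture.FinalStateConjecture.Theses.PhotonSphereChannels

/-!
# The no-extremal-remnant clause of `TameCensorship` is two-sided in time (negative-side read-back
support for crux `stmt-FinalStateConjecture-10047`, cdisprove seat, cycles 1–2)

Clause (iii) of `PhotonSphereChannels.TameCensorship` (and hypothesis (i) of
`ChannelsResolveTameDevelopments`) forbids, in every MGHD, late charts `Ψ` modelled on
`boostedKerrBackground Λ c M a` with `Kerr.IsExtremal M a` whose truncated `C²` deviation tends to `0`,
for EVERY `Λ : lorentzGroup`. This file records, as checked statements, that `lorentzGroup` is the full
`O(1,3)`: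

* `timeReversal_mem_lorentzGroup` — time reversal `T` is an admissible motion;
* `poincareInv_T_apply_zero`, `mem_lateRegion_T_iff`, `mem_timeSlab_T_iff`, `tendsto_ambientTime_T` —
  for the motion `(T, c)` the background's rest-frame time is `t*(x) = c⁰ − x⁰`, its "late region"
  `{t* > τ₀}` is the coordinate PAST `{x⁰ < c⁰ − τ₀}`, its slabs `{t* = τ}` are the ambient slabs
  `{x⁰ = c⁰ − τ}`, and along the clause's limit `τ → +∞` the ambient time tends to `−∞`.

Consequence (read-back for provers and planners): the clause also forbids PAST-asymptotic (white-hole)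
extremal Kerr exteriors of the two-sided maximal development — a dynamical third law for the
time-reversed datum. The assembly `closes` applies the clause only to charts into
`exteriorOf ⊆ J⁺(ιΣ)`, so restricting (iii) to charts into `causalFuture (range embed)` would lose
nothing the route uses (triage round 1, finding R2; ideator-1 recommendation).
-/

noncomputable section

open Bundle TopologicalSpace Manifold Set
open scoped ContDiff Topology InnerProductSpace RealInnerProductSpace

namespace Summit.FinalStateConjecture.FinalStateConjecture.Theorems.TameCensorship.Negative

open Literature.Geometry.Lorentzian

/-- Time reversal `T(v) = v - 2 v⁰ e₀`, i.e. `(T v)⁰ = -v⁰`, `(T v)ⁱ = vⁱ`, as a continuous linear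
self-map of `E4`. -/
def timeReversalCLM : E4 →L[ℝ] E4 :=
  ContinuousLinearMap.id ℝ E4 -
    (2 : ℝ) • (ContinuousLinearMap.smulRight (EuclideanSpace.proj (0 : Fin 4))
      (EuclideanSpace.single (0 : Fin 4) (1 : ℝ)))

/-- Coordinates of the time reversal: the time coordinate flips sign. -/
@[simp] theorem timeReversalCLM_apply_zero (v : E4) : timeReversalCLM v 0 = -v 0 := by
  simp [timeReversalCLM]; ring

/-- Coordinates of the time reversal: spatial coordinates are fixed. -/
@[simp] theorem timeReversalCLM_apply_succ (v : E4) (i : Fin 3) :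
    timeReversalCLM v i.succ = v i.succ := by
  simp [timeReversalCLM, Fin.succ_ne_zero]

/-- Time reversal is an involution. -/
theorem timeReversalCLM_involutive (v : E4) : timeReversalCLM (timeReversalCLM v) = v := by
  ext j
  refine Fin.cases ?_ (fun i ↦ ?_) j
  · rw [timeReversalCLM_apply_zero, timeReversalCLM_apply_zero, neg_neg]
  · rw [timeReversalCLM_apply_succ, timeReversalCLM_apply_succ]

/-- Time reversal as a continuous linear automorphism of `E4`. -/
def timeReversal : E4 ≃L[ℝ] E4 :=
  ContinuousLinearEquiv.equivOfInverse timeReversalCLM timeReversalCLM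
    timeReversalCLM_involutive timeReversalCLM_involutive

/-- **Time reversal is a Lorentz transformation of the prelude's `lorentzGroup = O(1,3)`** (the FULL
group of linear `η`-isometries), hence an admissible motion `Λ` in the no-extremal-remnant clause of
`TameCensorship`, of `ChannelsResolveTameDevelopments` and in `FinalStateDecomposition.motion`. -/
theorem timeReversal_mem_lorentzGroup : timeReversal ∈ lorentzGroup := by
  rw [mem_lorentzGroup_iff]
  intro v w
  change Minkowski.bilin (timeReversalCLM v) (timeReversalCLM w) = Minkowski.bilin v w
  simp [Minkowski.bilin_apply]

/-! ### The time-reversed extremal background: its "late" slabs recede into the coordinate past -/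

/-- Time reversal as an element `T` of the Lorentz group `O(1,3)` of the prelude. -/
def timeReversalLorentz : lorentzGroup := ⟨timeReversal, timeReversal_mem_lorentzGroup⟩

/-- The inverse of time reversal is time reversal. -/
@[simp] theorem timeReversal_symm_apply (v : E4) : timeReversal.symm v = timeReversalCLM v := rfl

/-- Unfolding lemma. -/
@[simp] theorem timeReversal_apply (v : E4) : timeReversal v = timeReversalCLM v := rfl

/-- Rest-frame time of the time-reversed motion `(T, c)`: `t*(x) = (T⁻¹(x − c))⁰ = c⁰ − x⁰`. -/
theorem poincareInv_T_apply_zero (c x : E4) : poincareInv timeReversalLorentz c x 0 = c 0 - x 0 := by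
  simp [poincareInv, timeReversalLorentz]
  ring

/-- **The late region of the time-reversed extremal background is a coordinate PAST.** For the
motion `Λ = T` (time reversal, an element of the full Lorentz group over which clause (iii) of
`TameCensorship` quantifies) the background's late region `{t* > τ₀}` is `{x⁰ < c⁰ − τ₀}`, and
its slabs `{t* = τ}` are the ambient slabs `{x⁰ = c⁰ − τ}`, receding to `x⁰ → −∞` as `τ → +∞`:
the no-extremal-remnant clause also forbids PAST-asymptotic (white-hole) extremal Kerr exteriors
of the two-sided maximal development (finding R2 of the crux triage round 1, now a checked statement). -/
theorem mem_lateRegion_T_iff {c : E4} {M a τ₀ : ℝ}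
    (x : (boostedKerrBackground timeReversalLorentz c M a).domain) :
    x ∈ (boostedKerrBackground timeReversalLorentz c M a).lateRegion τ₀ ↔ x.1 0 < c 0 - τ₀ := by
  rw [ModelBackground.mem_lateRegion]
  change τ₀ < poincareInv timeReversalLorentz c x.1 0 ↔ _
  rw [poincareInv_T_apply_zero]
  constructor <;> intro h <;> linarith

/-- The slabs of the time-reversed background are the ambient coordinate slabs `{x⁰ = c⁰ − τ}`. -/
theorem mem_timeSlab_T_iff {c : E4} {M a τ : ℝ}
    (x : (boostedKerrBackground timeReversalLorentz c M a).domain) :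
    x ∈ (boostedKerrBackground timeReversalLorentz c M a).timeSlab τ ↔ x.1 0 = c 0 - τ := by
  rw [ModelBackground.mem_timeSlab]
  change poincareInv timeReversalLorentz c x.1 0 = τ ↔ _
  rw [poincareInv_T_apply_zero]
  constructor <;> intro h <;> linarith

/-- Along the clause's limit `τ → +∞` the ambient time coordinate of the time-reversed slabs tends
to `−∞`. -/
theorem tendsto_ambientTime_T (c : E4) :
    Filter.Tendsto (fun τ : ℝ ↦ c 0 - τ) Filter.atTop Filter.atBot :=
  Filter.tendsto_atBot_add_const_left _ _ Filter.tendsto_neg_atTop_atBot |>.congr fun τ ↦ by ring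

end Summit.FinalStateConjecture.FinalStateConjecture.Theorems.TameCensorship.Negative

end
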